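import Literature.MathematicalPhysics.QuantumFieldTheory.Balaban1983to89.B13Eq216FirstForm

/-!
# `Balaban1983to89.B13Bound226Primitive` — T. Bałaban, *Renormalization group approach to lattice gauge field
theories. II. Cluster expansions*, Commun. Math. Phys. **116** (1988) 1–22 [Balaban1988RG2Cluster], pp. 15–17: the
bound (2.26) of the generic term (2.14) with EVERY in-paper step of pp. 15–17 kernel-checked and the hypotheses
reduced to the PRIMITIVE cross-paper inputs — the capstone of the chain `B13CauchyDecay` → `B13FirstEstimate215` →
`B13Replacement223` → `B13Integral223` → `B13Bound226Assembly` → `B13Bound226From216` → `B13Eq216AnalyticStep` →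
`B13Eq216FirstForm`: the three replacement kernels `R₁`, `R₂`, `R₃` of p. 16 and the identities defining them are no
longer hypotheses but CONSTRUCTED from the `Γ`-kernel `G(σ)`, the covariance `C_σ = A(σ)⁻¹`, the precision `A(σ)` and
their `σ = 0`, `(U, 0)` values `Γ₀`, `C`, `C⁻¹`.

statement-level skeleton of published theorems with citation tags; proofs where landed; nothing here is a claim about
the Yang–Mills mass gap

PDF held: `paper:balaban1988-cmp116-rg-ii-cluster` (journal page = PDF page + 0); pp. 15–17 (materialised
`p0015.txt`–`p0017.txt`, render `…-p016-x2.png`, cell transcript `pub-balaban/b2b-balaban-b13/transcript-B13.md`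
ll. 144–165).

CITATION HEADER (verbatim, p. 15 [PDF 15] and p. 17 [PDF 17]): *"In the expression on the right-hand side we replace the
operators by the corresponding operators with σ(Z) = 0, 𝐔 = U, 𝐉 = 0, and we estimate the error."* … *"This ends the
estimate of the expression (2.14). Gathering together all the bounds we get*
`|(2.14)| ≦ exp(−(κ₁ − 1)(LM)⁻⁴|Z∖Z′₀|)[Π_{Y∈𝐃} 2E₀ε₁C₁α₄⁻¹M^q exp C₂κ₁ exp(−(1 − 3δ)κd_k(Y))] exp(−½γ₂(ε₁²/g_k²)|P|) · exp O(1)α₅|Z|.`  (2.26)"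

WHAT IS REPRODUCED (unit `lit-balaban-r10` gen 11, B13 fold owner; SKELETON rows `B13.Eq2.26`, `B13.Eq2.16`,
`B13.Eq2.15` of `HOME/lit-balaban-r10/ROWS-B13.md`).
* §1 `hdef3_of_linear`, `h216R3_of_diff`, `continuous_of_linear` — for the LINEAR `Γ`-operator `Γ(σ)X = G(σ)·X`:
  `Re Γ(σ)X = (Γ₀ + R₃(σ))X` with `R₃(σ) := Re G(σ) − Γ₀` (the hypothesis `hdef3` of `B13Bound226From216`), the
  entrywise (2.16) for `R₃(σ)` from that of `G(σ) − Γ₀`, and the continuity of `X ↦ Γ(σ)X` (the hypothesis `hΓc`).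
* §2 **`norm_term214_le_226_of_primitives`** — (2.26) for the typed term (2.14)
  `B13Term214.term214 r lZ lD (core214 A Γ (F214 …)) σ₀ τ₀` from: separate analyticity in (σ, τ) and the (2.20)/(2.22)
  shapes (as in `B13Bound226Assembly`); `A(σ)` symmetric with `Re A(σ) ≻ 0`; the `Γ`-operator linear with kernel
  `G(σ)`; and, uniformly on the σ-polydisc, ENTRYWISE bounds on located bonds at rate `κ` — the uniform localisation of
  `G(σ)`, `Γ₀`, `C_σ = A(σ)⁻¹`, `C` (constants `K_G`, `K_Γ`, `K_{Cσ}`, `K₀`: the random-walk expansions of [13]/[15], L17a)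
  and the (2.16)-type bounds of the three DIFFERENCES `G(σ) − Γ₀` (`θ_Γ`), `C_σ − C` (`θ_C`), `A(σ) − C⁻¹` (`θ_E`) (the leaf
  L16a for the primitive objects; their `(𝐔, 𝐉)`-parts are `B13Eq216AnalyticStep`) — with any common majorant `θ` of
  `θ_E`, `θ_Γ` and the `R₁`-constant of `B13Eq216FirstForm.h216R1_of_factors`, at the twice-dropped rate `κ″`
  (`κ > κ′ > κ″ > 0`), and the smallness `K′θ′ < 1`, `α₅c ≤ ½`, `α₅(1 + 2cg) ≤ ½`.
HONEST SCOPE.  Plumbing only (every step is one of the landed theorems).  By-assertion inputs after this file, for the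
typed generic term: the localisation and difference bounds of the PRIMITIVE operators `C^{(k)}(Z₀, σ)`, its inverse,
`Γ_k(Z₀, σ)` (cross-paper [13]/[15], loci L16a/L17a; print's σ-part `O(1)e^{−⅓δ₀M}`), the eigenvalue/norm bounds `c`,
`g`, (2.20)/(2.22) in their printed shapes, separate analyticity; and upstream the (2.14)-representation of H(Z)
(`B13Representation214`).  No `sorry`, no definition, no new named fact (D-0026).
-/

noncomputable section

namespace Literature.MathematicalPhysics.QuantumFieldTheory.Balaban1983to89.B13Bound226Primitive

open Complex MeasureTheory Metric Finset Matrix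
open B2Lemma25Proof (l1dist l1dist_nonneg)
open B13Term214 (SepHolOn term214 core214 F214)
open B13Bound226From216 (norm_term214_le_226_of_216)
open B13Eq216FirstForm (hdef1_of_linear h216R1_of_factors entry_bound_mono_rate)

/-! ## §1. The linear `Γ`-operator: `hdef3`, `h216R3`, `hΓc` -/

section Linear

variable {ν : ℕ} {Λ N : Type} [Fintype Λ] [Fintype N]

omit [Fintype Λ] in
/-- **`hdef3` for a linear `Γ`-operator**: if `Γ(σ)X = G·X` (complex `Λ × N` kernel, real `X`), then
`Re (Γ(σ)X)_i = ((Γ₀ + R₃)X)_i` with `R₃ := Re G − Γ₀` — *"the difference between the new bilinear form and the form in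
(2.15) is a bilinear from ⟦sic⟧ −⟨B, R₃X⟩"*. [cite: Balaban1988RG2Cluster, (2.16) p.16] -/
theorem hdef3_of_linear (G : Matrix Λ N ℂ) (Γσ : (N → ℝ) → (Λ → ℂ))
    (hlin : ∀ X : N → ℝ, Γσ X = G *ᵥ fun j => (X j : ℂ)) (Γ₀ : Matrix Λ N ℝ) (X : N → ℝ) (i : Λ) :
    (Γσ X i).re = ((Γ₀ + (G.map Complex.re - Γ₀)) *ᵥ X) i := by
  rw [add_sub_cancel, hlin X]
  simp only [Matrix.mulVec, dotProduct, Complex.re_sum, Matrix.map_apply]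
  refine Finset.sum_congr rfl fun j _ => ?_
  rw [Complex.mul_re, Complex.ofReal_re, Complex.ofReal_im, mul_zero, sub_zero]

omit [Fintype Λ] [Fintype N] in
/-- **`h216R3` from the difference kernel**: `‖(Re G − Γ₀)(i,j)‖ ≤ ‖(G − Γ₀)(i,j)‖`, so an entrywise (2.16) for
`G(σ) − Γ₀` gives one for `R₃(σ) = Re G(σ) − Γ₀`. [cite: Balaban1988RG2Cluster, (2.16) p.16] -/
theorem h216R3_of_diff {G : Matrix Λ N ℂ} {Γ₀ : Matrix Λ N ℝ} {g : Λ → N → ℝ}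
    (hd : ∀ i j, ‖(G - Γ₀.map (algebraMap ℝ ℂ)) i j‖ ≤ g i j) (i : Λ) (j : N) :
    ‖(G.map Complex.re - Γ₀) i j‖ ≤ g i j := by
  have hre : (G.map Complex.re - Γ₀) i j = ((G - Γ₀.map (algebraMap ℝ ℂ)) i j).re := by
    rw [Matrix.sub_apply, Matrix.sub_apply, Matrix.map_apply, Matrix.map_apply, Complex.sub_re,
      Complex.coe_algebraMap, Complex.ofReal_re]
  rw [hre, Real.norm_eq_abs]
  exact (Complex.abs_re_le_norm _).trans (hd i j)

omit [Fintype Λ] in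
/-- **`hΓc` for a linear `Γ`-operator**: `X ↦ G·X` is continuous (*"Γ_k(Z₀, σ(Z)) = C*Δ_k(σ(Z))CZ₀ᶜ(C^{(k)})^{1/2}(σ(Z))"*
is a linear operator). [cite: Balaban1988RG2Cluster, (2.14) p.15] -/
theorem continuous_of_linear (G : Matrix Λ N ℂ) (Γσ : (N → ℝ) → (Λ → ℂ))
    (hlin : ∀ X : N → ℝ, Γσ X = G *ᵥ fun j => (X j : ℂ)) : Continuous Γσ := by
  have h : Γσ = fun X => G *ᵥ fun j => (X j : ℂ) := funext hlin
  rw [h]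
  exact Continuous.matrix_mulVec continuous_const
    (continuous_pi fun j => Complex.continuous_ofReal.comp (continuous_apply j))

end Linear

/-! ## §2. (2.26) from the primitive objects -/

section Capstone

variable {ν : ℕ} {Λ : Type} [Fintype Λ] [DecidableEq Λ] {C₀ : Type} [Fintype C₀] [DecidableEq C₀]
variable {ι κ : Type*} [DecidableEq ι] [DecidableEq κ]

/-- **(2.26) for the typed term (2.14) from the PRIMITIVE objects.**  Hypotheses: the Cauchy/analyticity data of
`B13Bound226Assembly` (σ-radius `e^{κ₁}`, `κ₁ ≥ 1`; τ-radii `R_τ(Y) ≥ 2`; separate holomorphy of `∫dμ₀(X)|_Z (lines 2–4)`;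
base points in the unit polydiscs); the (2.22) and (2.20) shapes; and, uniformly for the `σ` of the σ-polydisc: `A(σ)`
symmetric with `Re A(σ) ≻ 0`; the `Γ`-operator LINEAR, `Γ(σ)X = G(σ)·X`; ENTRYWISE bounds on bonds located on ℤ^ν
(`Λ` = bonds of `Z₀` with `≤ m` per site, `N = Λ ⊕ C₀` = bonds of `Z` with `≤ m` per site) at rate `κ`: localisation of
`G(σ)` (`K_G`), `Γ₀` (`K_Γ`), `C_σ = A(σ)⁻¹` (`K_{Cσ}`), `C` (`K₀`), and (2.16)-type bounds of the differences `G(σ) − Γ₀`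
(`θ_Γ`), `A(σ)⁻¹ − C` (`θ_C`), `A(σ) − C⁻¹` (`θ_E`); rates `κ > κ′ > κ″ > 0`; a common majorant `θ` of `θ_E`, `θ_Γ` and
the `R₁`-constant `m(1+2/(κ−κ′))^ν·m(1+2/(κ′−κ″))^ν·(θ_ΓK_{Cσ}K_G + K_Γθ_CK_G + K_ΓK₀θ_Γ)`; smallness `K′θ′ < 1`
(`K′ = K₀m(1+2/κ)^ν`, `θ′ = θm(1+2/κ″)^ν`), `α₅c ≤ ½`, `α₅(1+2cg) ≤ ½` (`α₅ = 2θ′ + γ₂ + a`).  Conclusion: (2.26),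
`|(2.14)| ≤ exp(−(κ₁ − 1)|lZ|)·[Π_{Y∈𝐃} 2/R_τ(Y)]·e^{2η|Λ|}·exp(−½γ₂(ε₁²/g_k²)|P| + w)·e^{α₅c|Λ|}·e^{α₅(1+2cg)|N|}` —
`B13Bound226From216.norm_term214_le_226_of_216` with `R₁ := Γ₀ᵀCΓ₀ − Re(G(σ)ᵀA(σ)⁻¹G(σ))`
(`B13Eq216FirstForm.hdef1_of_linear` / `h216R1_of_factors`), `R₃ := Re G(σ) − Γ₀` (`hdef3_of_linear` / `h216R3_of_diff`),
`hΓc` := `continuous_of_linear`. [cite: Balaban1988RG2Cluster, (2.14)–(2.15) p.15, (2.16)–(2.22) p.16, (2.23)–(2.26) p.17] -/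
theorem norm_term214_le_226_of_primitives {κ₁ : ℝ} (hκ₁ : 1 ≤ κ₁) (Rτ : κ → ℝ) (hRτ : ∀ Y, 2 ≤ Rτ Y)
    {Uσ Uτ : Set ℂ} (hUσ : IsOpen Uσ) (hUτ : IsOpen Uτ) (hUexp : closedBall (0 : ℂ) (Real.exp κ₁) ⊆ Uσ)
    (hUtau : ∀ Y, closedBall (0 : ℂ) (Rτ Y) ⊆ Uτ) {r : ℝ} (hr : 0 < r) (hr' : r ≤ Real.exp κ₁ - 1)
    (hsubτ : ∀ s ∈ Set.uIcc (0 : ℝ) 1, closedBall (s : ℂ) r ⊆ Uτ)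
    (A : (ι → ℂ) → Matrix Λ Λ ℂ) (Γ : (ι → ℂ) → (Λ ⊕ C₀ → ℝ) → (Λ → ℂ))
    (cardP : ℕ) (χY₀ χcP : (Λ → ℝ) → ℝ) (hχ0 : ∀ B, 0 ≤ χY₀ B) (hχc0 : ∀ B, 0 ≤ χcP B) (Dfam : Finset κ)
    (V : κ → (Λ → ℝ) → ℂ)
    (hΨσ : ∀ τ : κ → ℂ, (∀ j, τ j ∈ Uτ) → SepHolOn Uσ (fun σ => core214 A Γ (F214 cardP χY₀ χcP Dfam V) σ τ))
    (hΨτ : ∀ σ : ι → ℂ, (∀ j, σ j ∈ Uσ) → SepHolOn Uτ (fun τ => core214 A Γ (F214 cardP χY₀ χcP Dfam V) σ τ))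
    {C : Matrix Λ Λ ℝ} (hC : C.PosDef) (Γ₀ : Matrix Λ (Λ ⊕ C₀) ℝ)
    (hAs : ∀ σ : ι → ℂ, (∀ j, ‖σ j‖ ≤ Real.exp κ₁) → (A σ).IsSymm)
    (hA : ∀ σ : ι → ℂ, (∀ j, ‖σ j‖ ≤ Real.exp κ₁) → ((A σ).map Complex.re).PosDef)
    -- the Γ-operator is linear with kernel G(σ)
    (G : (ι → ℂ) → Matrix Λ (Λ ⊕ C₀) ℂ)
    (hlin : ∀ σ : ι → ℂ, (∀ j, ‖σ j‖ ≤ Real.exp κ₁) → ∀ X : Λ ⊕ C₀ → ℝ, Γ σ X = G σ *ᵥ fun j => (X j : ℂ))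
    {γ₂ rP a w : ℝ} (qP : (Λ → ℝ) → ℝ)
    (h222 : ∀ B, χY₀ B * χcP B ≤ Real.exp (-(γ₂ / 2 * rP ^ 2 * cardP) + γ₂ / 2 * qP B)) (hγ₂ : 0 ≤ γ₂)
    (hqP : ∀ B, qP B ≤ B ⬝ᵥ B) (h220R : ∀ B, ∑ Y ∈ Dfam, Rτ Y * ‖V Y B‖ ≤ a / 2 * (B ⬝ᵥ B) + w) (ha0 : 0 ≤ a)
    -- located bonds
    (locΛ : Λ → (Fin ν → ℤ)) (locN : Λ ⊕ C₀ → (Fin ν → ℤ)) {m : ℕ}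
    (hfibΛ : ∀ x : Fin ν → ℤ, (Finset.univ.filter fun i => locΛ i = x).card ≤ m)
    (hfibN : ∀ x : Fin ν → ℤ, (Finset.univ.filter fun j => locN j = x).card ≤ m)
    -- rates and constants
    {kap kap' kap'' θ θE θΓ θC KG KΓ KCs K₀ : ℝ} (hkap'' : 0 < kap'') (h1 : kap'' < kap') (h2 : kap' < kap)
    (hθE : 0 ≤ θE) (hθΓ : 0 ≤ θΓ) (hθC : 0 ≤ θC) (hKG : 0 ≤ KG) (hKΓ : 0 ≤ KΓ) (hKCs : 0 ≤ KCs) (hK₀ : 0 ≤ K₀)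
    (hθEle : θE ≤ θ) (hθΓle : θΓ ≤ θ)
    (hθR1le : (m * (1 + 2 / (kap - kap')) ^ ν) * (m * (1 + 2 / (kap' - kap'')) ^ ν)
      * (θΓ * KCs * KG + KΓ * θC * KG + KΓ * K₀ * θΓ) ≤ θ)
    -- uniform localisation of the primitive kernels (L17a)
    (hG : ∀ σ : ι → ℂ, (∀ j, ‖σ j‖ ≤ Real.exp κ₁) →
      ∀ b j, ‖G σ b j‖ ≤ KG * Real.exp (-(kap * l1dist (locΛ b) (locN j))))
    (hΓ₀ : ∀ b j, ‖Γ₀ b j‖ ≤ KΓ * Real.exp (-(kap * l1dist (locΛ b) (locN j))))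
    (hCs : ∀ σ : ι → ℂ, (∀ j, ‖σ j‖ ≤ Real.exp κ₁) →
      ∀ b b', ‖(A σ)⁻¹ b b'‖ ≤ KCs * Real.exp (-(kap * l1dist (locΛ b) (locΛ b'))))
    (hC216 : ∀ b b', ‖C b b'‖ ≤ K₀ * Real.exp (-(kap * l1dist (locΛ b) (locΛ b'))))
    -- the (2.16)-type differences of the primitive kernels (L16a)
    (hdΓ : ∀ σ : ι → ℂ, (∀ j, ‖σ j‖ ≤ Real.exp κ₁) →
      ∀ b j, ‖(G σ - Γ₀.map (algebraMap ℝ ℂ)) b j‖ ≤ θΓ * Real.exp (-(kap * l1dist (locΛ b) (locN j))))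
    (hdC : ∀ σ : ι → ℂ, (∀ j, ‖σ j‖ ≤ Real.exp κ₁) →
      ∀ b b', ‖((A σ)⁻¹ - C.map (algebraMap ℝ ℂ)) b b'‖ ≤ θC * Real.exp (-(kap * l1dist (locΛ b) (locΛ b'))))
    (hdE : ∀ σ : ι → ℂ, (∀ j, ‖σ j‖ ≤ Real.exp κ₁) →
      ∀ b b', ‖(A σ - C⁻¹.map (algebraMap ℝ ℂ)) b b'‖ ≤ θE * Real.exp (-(kap * l1dist (locΛ b) (locΛ b'))))
    (hsmallKθ : K₀ * (m * (1 + 2 / kap) ^ ν) * (θ * (m * (1 + 2 / kap'') ^ ν)) < 1)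
    -- the (2.24)–(2.25) smallness
    {c g : ℝ} (hc0 : 0 ≤ c) (hc : ∀ k, hC.1.eigenvalues k ≤ c)
    (hαc : (2 * (θ * (m * (1 + 2 / kap'') ^ ν)) + (γ₂ + a)) * c ≤ 1 / 2) (hg : 0 ≤ g)
    (hΓq : ∀ X : Λ ⊕ C₀ → ℝ, (Γ₀ *ᵥ X) ⬝ᵥ (C *ᵥ (Γ₀ *ᵥ X)) ≤ g * (X ⬝ᵥ X))
    (hsmall : (2 * (θ * (m * (1 + 2 / kap'') ^ ν)) + (γ₂ + a)) * (1 + 2 * c * g) ≤ 1 / 2)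
    {lZ : List ι} (hlZ : lZ.Nodup) {lD : List κ} (hlD : lD.Nodup)
    {σ₀ : ι → ℂ} (hσ₀ : ∀ j, ‖σ₀ j‖ ≤ 1) {τ₀ : κ → ℂ} (hτ₀ : ∀ Y, ‖τ₀ Y‖ ≤ 1) :
    ‖term214 r lZ lD (core214 A Γ (F214 cardP χY₀ χcP Dfam V)) σ₀ τ₀‖ ≤
      Real.exp (-(κ₁ - 1) * lZ.length) * (∏ Y ∈ lD.toFinset, 2 * (Rτ Y)⁻¹)
        * (Real.exp (2 * (K₀ * (m * (1 + 2 / kap) ^ ν) * (θ * (m * (1 + 2 / kap'') ^ ν))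
              * (1 + (1 - K₀ * (m * (1 + 2 / kap) ^ ν) * (θ * (m * (1 + 2 / kap'') ^ ν)))⁻¹) / 2) * Fintype.card Λ)
          * Real.exp (-(γ₂ / 2 * rP ^ 2 * cardP) + w)
          * (Real.exp ((2 * (θ * (m * (1 + 2 / kap'') ^ ν)) + (γ₂ + a)) * c * Fintype.card Λ)
            * Real.exp ((2 * (θ * (m * (1 + 2 / kap'') ^ ν)) + (γ₂ + a)) * (1 + 2 * c * g)
              * Fintype.card (Λ ⊕ C₀)))) := by
  have hθ : 0 ≤ θ := hθE.trans hθEle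
  have hkap : 0 < kap := hkap''.trans (h1.trans h2)
  have hkk : kap'' ≤ kap := (h1.trans h2).le
  -- R₁ and R₃ constructed from the primitive kernels
  refine norm_term214_le_226_of_216 hκ₁ Rτ hRτ hUσ hUτ hUexp hUtau hr hr' hsubτ A Γ cardP χY₀ χcP hχ0 hχc0 Dfam V
    hΨσ hΨτ hC Γ₀ hAs hA (fun σ hσ => continuous_of_linear (G σ) (Γ σ) (hlin σ hσ)) qP h222 hγ₂ hqP h220R ha0 hθ
    hkap'' hK₀ hkap locΛ locN hfibΛ hfibN
    (fun σ => Γ₀ᵀ * C * Γ₀ - ((G σ)ᵀ * (A σ)⁻¹ * G σ).map Complex.re)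
    (fun σ => (G σ).map Complex.re - Γ₀)
    (fun σ hσ X => hdef1_of_linear (A σ) (G σ) (Γ σ) (hlin σ hσ) C Γ₀ X)
    (fun σ hσ b b' => ?_) (fun σ hσ b b' => ?_)
    (fun σ hσ X i => hdef3_of_linear (G σ) (Γ σ) (hlin σ hσ) Γ₀ X i)
    (fun σ hσ i j => ?_) hC216 hsmallKθ hc0 hc hαc hg hΓq hsmall hlZ hlD hσ₀ hτ₀
  · -- h216R1: from the factor bounds, then to the common majorant θ
    have h := h216R1_of_factors hθΓ hθC hKG hKΓ hKCs hK₀ hkap''.le h1 h2 locΛ locN hfibΛ (hdΓ σ hσ) (hdC σ hσ)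
      (hG σ hσ) hΓ₀ (hCs σ hσ) hC216 b b'
    exact h.trans (mul_le_mul_of_nonneg_right hθR1le (Real.exp_pos _).le)
  · -- h216E: rate κ → κ″, constant θ_E → θ
    have h := entry_bound_mono_rate hθE hkk locΛ locΛ (hdE σ hσ) b b'
    exact h.trans (mul_le_mul_of_nonneg_right hθEle (Real.exp_pos _).le)
  · -- h216R3: from G(σ) − Γ₀, rate κ → κ″, constant θ_Γ → θ
    have hmono : ∀ i j, ‖(G σ - Γ₀.map (algebraMap ℝ ℂ)) i j‖
        ≤ θ * Real.exp (-(kap'' * l1dist (locΛ i) (locN j))) := fun i j =>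
      (entry_bound_mono_rate hθΓ hkk locΛ locN (hdΓ σ hσ) i j).trans
        (mul_le_mul_of_nonneg_right hθΓle (Real.exp_pos _).le)
    exact h216R3_of_diff hmono i j

end Capstone

end Literature.MathematicalPhysics.QuantumFieldTheory.Balaban1983to89.B13Bound226Primitive

end
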